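import Summits.NavierStokesRegularity.NavierStokesRegularity.Theorems.PerpetualPumpEulerTypeIGlueDensity
import Literature.Analysis.FluidPDE.NSCriticalClosureBesovKatoClass
import Literature.Analysis.FluidPDE.TaoCascadeProjection

/-!
# Route PerpetualPump · `EulerTypeIGlue` — stub `stub_identityTests` (line `Sketch`)

Tao's mild identity (2016, §1.1 (1.5)/(1.15)) at viscosity `ν`, tested against the
divergence-free test fields `φ ∈ C_{c,σ}^∞(ℝ³)` (`divFreeTest ℝ³`), for the complexified `L²`
curve `U t = [(u t)^ℂ] ∈ L²(ℝ³; ℂ³)` of a classical Leray–Hopf solution `u` on `[0,T)`: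
`⟨U t, φ⟩ = ⟨e^{νtΔ} U 0, φ⟩ + ∫₀ᵗ ⟨B(U s, U s), e^{ν(t-s)Δ} φ⟩ ds`.

This is a dictionary statement.  The physical-space duality identity
`∫⟪u t, φ⟫ = ∫⟪u 0, e^{νtΔ}φ⟫ + ∫₀ᵗ ∫⟪u τ, (u τ·∇) e^{ν(t-τ)Δ}φ⟫ dτ` (Fabes–Jones–Rivière 1972,
Thm. 2.1) is the mild clause of `isKatoSolutionOn_of_classical`; its three terms are carried to
Tao's side by `pairing_eq_integral_inner_of_ae_eq` (the bilinear pairing of complexified real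
fields is the real `L²` pairing), `pairing_heat_left` + `heat_toLp_eq_toLp_heatFlow` (Tao's
Fourier-multiplier `e^{τΔ}` is self-adjoint and is the Gauss–Weierstrass flow `heatFlow`), and the
cubic Plancherel identity `⟨B([f^ℂ],[f^ℂ]),[ψ^ℂ]⟩ = ∫⟪f,(f·∇)ψ⟫` (hypothesis `hcubic`, applied at
each time `s ∈ [0,t]` to `f = u s` and the caloric test field `ψ = e^{ν(t-s)Δ}φ`, which is
`C¹`, integrable with integrable derivative, and square integrable: `caloricTest_regularity`).

## References

* T. Tao, *Finite time blowup for an averaged three-dimensional Navier–Stokes equation*,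
  J. Amer. Math. Soc. 29 (2016), arXiv:1402.0290v3, §1.1 (1.5), (1.15). [Tao2016AveragedNS]
* E. B. Fabes, B. F. Jones, N. M. Rivière, Arch. Rational Mech. Anal. 45 (1972), Thm. 2.1.
-/

noncomputable section

open MeasureTheory Set Filter Topology FourierTransform
open scoped ENNReal NNReal RealInnerProductSpace SchwartzMap ContDiff

set_option linter.dupNamespace false

namespace Summit.NavierStokesRegularity.NavierStokesRegularity.Theorems.PerpetualPumpEulerTypeIGlue

open Literature.Analysis.FluidPDE Literature.Analysis.FluidPDE.Tao2016
open Literature.Analysis.FunctionSpaces (eFourierSobolevNorm)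
open Literature.Analysis.FunctionSpaces.EuclideanSpace (complexify complexify_apply norm_complexify
  continuous_complexify)

/-- Local notation for physical / frequency space `ℝ³`. -/
local notation "ℝ³" => EuclideanSpace ℝ (Fin 3)
/-- Local notation for the complexified range `ℂ³`. -/
local notation "ℂ³" => EuclideanSpace ℂ (Fin 3)

/-! ### The caloric test field `e^{σΔ}φ` of a divergence-free test field -/

/-- **Regularity of the caloric test field**: for `φ ∈ C_{c,σ}^∞(ℝ³)` and every `σ ∈ ℝ`, the
field `ψ = heatFlow φ σ` (`= e^{σΔ}φ` for `σ > 0`, `= φ` for `σ ≤ 0`) is `C¹`, integrable, has an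
integrable derivative (`Dψ = e^{σΔ} Dφ`), and its complexification is square integrable
(derivatives fall on the compactly supported data; `L¹`/`L²` contractivity of the heat flow).
[folklore] -/
theorem caloricTest_regularity {φ : ℝ³ → ℝ³} (hφ : φ ∈ divFreeTest ℝ³) (σ : ℝ) :
    ContDiff ℝ 1 (heatFlow φ σ) ∧ Integrable (heatFlow φ σ) ∧
      Integrable (fderiv ℝ (heatFlow φ σ)) ∧
      MemLp (complexify ∘ heatFlow φ σ) 2 (volume : Measure ℝ³) := by
  have hc : HasCompactSupport φ := hφ.1.hasCompactSupport
  have h1 : ContDiff ℝ 1 φ := hφ.1.contDiff.of_le (by exact_mod_cast le_top)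
  refine ⟨contDiff_heatFlow h1 hc σ,
    integrable_heatFlow (hφ.1.contDiff.continuous.integrable_of_hasCompactSupport hc) σ, ?_,
    memLp_complexify_of_memLp (memLp_heatFlow_of_memLp (memLp_of_mem_divFreeTest hφ 2) one_le_two σ)⟩
  have heq : fderiv ℝ (heatFlow φ σ) = heatFlow (fderiv ℝ φ) σ := funext (fderiv_heatFlow h1 hc σ)
  rw [heq]
  exact integrable_heatFlow
    ((h1.continuous_fderiv one_ne_zero).integrable_of_hasCompactSupport (hc.fderiv ℝ)) σ

/-! ### Tao's identity (1.15) at viscosity `ν` for test fields -/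

/-- **Tao's identity (1.15) at viscosity `ν` for divergence-free test fields**: for the
complexified curve `U t = [(u t)^ℂ]` of a classical Leray–Hopf solution, every `t ∈ [0,T)` and
every `φ ∈ C_{c,σ}^∞`,
`⟨U t, φ⟩ = ⟨e^{νtΔ} U 0, φ⟩ + ∫₀ᵗ ⟨B(U s, U s), e^{ν(t-s)Δ} φ⟩ ds` (x-mild identity of
`isKatoSolutionOn_of_classical` + heat dictionary + the cubic identity `hcubic`).
[cite: Tao2016AveragedNS, §1.1 (1.5), (1.15)] -/
theorem stub_identityTests {ν T : ℝ} (hν : 0 < ν) (hT : 0 < T) {u : ℝ → ℝ³ → ℝ³} {p : ℝ → ℝ³ → ℝ}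
    (hcl : IsClassicalNSSolutionOn (Ico 0 T) ν 0 u p) (hLH : IsLerayHopfOn T ν 0 (u 0) u)
    (hdec : HasRapidSpatialDecay (u 0)) (U : ℝ → L2C)
    (hU : ∀ t ∈ Ico 0 T, ((U t : L2C) : ℝ³ → ℂ³) =ᵐ[volume] complexify ∘ u t)
    (hH : ∀ t ∈ Ico 0 T, MemH10df (U t))
    (hcubic : ∀ {f ψ : ℝ³ → ℝ³} (_ : Continuous f) (h2 : MemLp (complexify ∘ f) 2 (volume : Measure ℝ³))
      (_ : eFourierSobolevNorm 10 (h2.toLp _) < ⊤) (_ : IsFourierDivFree (h2.toLp _))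
      (_ : ContDiff ℝ 1 ψ) (_ : Integrable ψ) (_ : Integrable (fderiv ℝ ψ))
      (hψ2 : MemLp (complexify ∘ ψ) 2 (volume : Measure ℝ³)),
      eulerForm (h2.toLp _) (h2.toLp _) (hψ2.toLp _) = ((∫ x, ⟪f x, convect f ψ x⟫ : ℝ) : ℂ)) :
    ∀ t ∈ Ico 0 T, ∀ φ ∈ divFreeTest ℝ³, ∀ (h2φ : MemLp (complexify ∘ φ) 2 (volume : Measure ℝ³)),
      pairing (U t) (h2φ.toLp _) = pairing (heat (ν * t) (U 0)) (h2φ.toLp _) +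
        ∫ s in (0:ℝ)..t, eulerForm (U s) (U s) (heat (ν * (t - s)) (h2φ.toLp _)) := by
  intro t ht φ hφ h2φ
  have h0T : (0 : ℝ) ∈ Ico 0 T := ⟨le_rfl, hT⟩
  -- (1) the physical-space mild identity (Fabes–Jones–Rivière) of the classical solution
  have hK : IsKatoSolutionOn T ν (u 0) u := isKatoSolutionOn_of_classical hν hT hcl hLH hdec
  have hmild : ∫ x, ⟪u t x, φ x⟫ = (∫ x, ⟪u 0 x, heatFlow φ (ν * t) x⟫) +
      ∫ τ in (0:ℝ)..t, ∫ x, ⟪u τ x, convect (u τ) (heatFlow φ (ν * (t - τ))) x⟫ := by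
    have h := hK.mild.2 t ht φ hφ.1 hφ.2
    simp only [heatTest, Pi.zero_apply, inner_zero_left, integral_zero,
      intervalIntegral.integral_zero, add_zero] at h
    exact h
  -- (2) the left-hand side
  rw [pairing_eq_integral_inner_of_ae_eq (hU t ht) h2φ]
  -- (3) the datum term: `⟨e^{νtΔ} U 0, φ⟩ = ⟨U 0, e^{νtΔ} φ⟩ = ∫⟪u 0, e^{νtΔ}φ⟫`
  have hh0 : MemLp (complexify ∘ heatFlow φ (ν * t)) 2 (volume : Measure ℝ³) :=
    (caloricTest_regularity hφ (ν * t)).2.2.2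
  rw [pairing_heat_left, heat_toLp_eq_toLp_heatFlow h2φ (mul_nonneg hν.le ht.1) hh0,
    pairing_eq_integral_inner_of_ae_eq (hU 0 h0T) hh0]
  -- (4) the Duhamel term, pointwise in `s ∈ [0, t]`, through the cubic identity
  have hI : ∀ s ∈ uIcc (0:ℝ) t, eulerForm (U s) (U s) (heat (ν * (t - s)) (h2φ.toLp _)) =
      ((∫ x, ⟪u s x, convect (u s) (heatFlow φ (ν * (t - s))) x⟫ : ℝ) : ℂ) := by
    intro s hs
    rw [uIcc_of_le ht.1] at hs
    have hs' : s ∈ Ico 0 T := ⟨hs.1, hs.2.trans_lt ht.2⟩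
    have h2s : MemLp (complexify ∘ u s) 2 (volume : Measure ℝ³) := (Lp.memLp (U s)).ae_eq (hU s hs')
    have hUs : U s = h2s.toLp _ := Lp.ext ((hU s hs').trans h2s.coeFn_toLp.symm)
    have hHs : MemH10df (U s) := hH s hs'
    rw [hUs] at hHs ⊢
    obtain ⟨hψ1, hψi, hψi', hψ2⟩ := caloricTest_regularity hφ (ν * (t - s))
    rw [heat_toLp_eq_toLp_heatFlow h2φ (mul_nonneg hν.le (sub_nonneg.2 hs.2)) hψ2]
    exact hcubic (hcl.contDiff_velocity hs').continuous h2s hHs.1 hHs.2.2 hψ1 hψi hψi' hψ2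
  have hI' : (∫ s in (0:ℝ)..t, eulerForm (U s) (U s) (heat (ν * (t - s)) (h2φ.toLp _))) =
      ((∫ s in (0:ℝ)..t, ∫ x, ⟪u s x, convect (u s) (heatFlow φ (ν * (t - s))) x⟫ : ℝ) : ℂ) := by
    rw [← intervalIntegral.integral_ofReal]
    exact intervalIntegral.integral_congr hI
  -- (5) assemble
  rw [hI', hmild, Complex.ofReal_add]

end Summit.NavierStokesRegularity.NavierStokesRegularity.Theorems.PerpetualPumpEulerTypeIGlue

end
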